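import Summits.ResolutionOfSingularities.ResolutionOfSingularities.Theorems.PurelyInseparableDim4ScopeDictionary
import Mathlib.Data.Nat.Choose.Lucas
import Mathlib.NumberTheory.Padics.PadicVal.Basic
import HarnessLib
import HarnessLib.Audit.Tags

/-!
# Purely inseparable fourfolds — PERMISSIBLE ⟺ `J_q⁺(F) ≤ (x_S)` at every prime power `q = p^e`
# [OURS · counted 0 · statements about OUR frame (`PurelyInseparableDim4Scope`), not about resolution]

Census cell «res-dim4-pi» (D-0157 DOOR 2), width seat `res-dim4-p-14`, brick PR-12s; extends PR-12l
(`ScopeDictionary`, the class of record `q = p`) to every exponent `q = p^e` the engines implement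
(`e ≤ 3`, ADD-1 (A); the printed calibration zoo lives at `e ≥ 2`).  For `F` clean w.r.t. `q` (no
monomial all of whose exponents are divisible by `q`) over a field of characteristic `p`:

* `not_dvd_choose_pow_padicValNat` — LUCAS: `p ∤ C(n, p^{v_p(n)})` for `n ≠ 0` (the digit of `n` at
  position `v_p(n)` is non-zero);
* **`le_ordAlong_of_singLocusIdeal_le_span_X`** (`q = p^e`): `J_q⁺(F) ≤ (x_S) → q ≤ ord_{(x_S)} F` — a
  monomial of `S`-degree `m ∈ (0, q)` is detected by `D^{(d|_S)}` exactly as at `e = 1`; one of `S`-degree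
  `0` by `D^{(p^v eᵢ)}` with `v = v_p(dᵢ) < e` for an exponent `dᵢ` not divisible by `q` (coefficient
  `C(dᵢ, p^v)·coeff_d F ≠ 0` in characteristic `p` by Lucas);
* **`isPermissibleCentre_iff_singLocusIdeal_le`** (`q = p^e`, `S ≠ ∅`, clean `F`).

Nothing here proves resolution of singularities in dimension ≥ 4 / characteristic `p`; counted 0;
AI work, weaker than expert review.
bears_on: LADDER-RESOLUTION:D157-DOOR2 (res-dim4-pi · PR-12s). Supports stmt-ResolutionOfSingularities-16155
(helper).
-/

set_option linter.dupNamespace false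

noncomputable section

namespace Summit.ResolutionOfSingularities.ResolutionOfSingularities.Theorems.PIDim4

namespace ScopeDictionaryPrimePower

open MvPolynomial
open Literature.AlgebraicGeometry.Resolution

/-! ## 1. Lucas: `p ∤ C(n, p^{v_p(n)})` -/

/-- One Lucas step: `C(p·n, p·k) ≡ C(n, k) (mod p)`. [folklore] -/
theorem choose_mul_modEq (p : ℕ) [hp : Fact p.Prime] (n k : ℕ) :
    (p * n).choose (p * k) ≡ n.choose k [MOD p] := by
  have h := Choose.choose_modEq_choose_mod_mul_choose_div_nat (n := p * n) (k := p * k) (p := p)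
  rwa [Nat.mul_mod_right, Nat.mul_mod_right, Nat.choose_zero_right, one_mul,
    Nat.mul_div_cancel_left _ hp.out.pos, Nat.mul_div_cancel_left _ hp.out.pos] at h

/-- **Lucas at the lowest non-zero digit**: for `n ≠ 0`, `p` does not divide `C(n, p^{v_p(n)})`.
[folklore] -/
theorem not_dvd_choose_pow_padicValNat (p : ℕ) [hp : Fact p.Prime] {n : ℕ} (hn : n ≠ 0) :
    ¬ p ∣ n.choose (p ^ padicValNat p n) := by
  -- induction on the valuation
  suffices h : ∀ v n, n ≠ 0 → padicValNat p n = v → ¬ p ∣ n.choose (p ^ v) from h _ n hn rfl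
  intro v
  induction v with
  | zero =>
    intro n hn hv
    rw [pow_zero, Nat.choose_one_right]
    intro hdvd
    have : 1 ≤ padicValNat p n := one_le_padicValNat_of_dvd hn hdvd
    omega
  | succ v ih =>
    intro n hn hv
    have hpn : p ∣ n := by
      have : p ^ 1 ∣ n := (padicValNat_dvd_iff_le hn).mpr (by omega)
      rwa [pow_one] at this
    obtain ⟨n', rfl⟩ := hpn
    have hn' : n' ≠ 0 := fun h0 => hn (by rw [h0, mul_zero])
    have hv' : padicValNat p n' = v := by
      have h := padicValNat.mul (p := p) hp.out.ne_zero hn'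
      rw [padicValNat_self] at h
      omega
    rw [pow_succ', Nat.ModEq.dvd_iff (choose_mul_modEq p n' (p ^ v)) (dvd_refl p)]
    exact ih n' hn' hv'

/-! ## 2. The converse at `q = p^e` -/

variable {K : Type} [Field K]

/-- **`J_q⁺(F) ≤ (x_S) ⇒ q ≤ ord_{(x_S)} F`** for `q = p^e` and `F` clean w.r.t. `q` (every monomial has
an exponent not divisible by `q`), over a field of characteristic `p`. [folklore] -/
theorem le_ordAlong_of_singLocusIdeal_le_span_X {p e : ℕ} [hp : Fact p.Prime] [CharP K p] {q : ℕ}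
    (hq : q = p ^ e) {S : Finset (Fin 4)} {F : MvPolynomial (Fin 4) K}
    (hclean : ∀ d ∈ F.support, ∃ i, ¬ q ∣ d i)
    (hJ : singLocusIdeal q F ≤ Ideal.span ((fun i => (X i : MvPolynomial (Fin 4) K)) '' (S : Set (Fin 4)))) :
    (q : ℕ∞) ≤ CentreBlowup.ordAlong S F := by
  classical
  refine CentreBlowup.le_ordAlong_of_forall fun d hd => ?_
  have hcd : coeff d F ≠ 0 := MvPolynomial.mem_support_iff.mp hd
  by_contra hlt
  push Not at hlt
  by_cases hm : CentreBlowup.degIn S d = 0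
  · -- no variable of `S` occurs in `x^d`: detect it with `D^{(p^v eᵢ)}`, `v = v_p(dᵢ)`, `q ∤ dᵢ`
    obtain ⟨i, hi⟩ := hclean d hd
    have hdi : d i ≠ 0 := fun h0 => hi (by rw [h0]; exact dvd_zero q)
    have hiS : i ∉ S := fun hiS => hdi ((Finset.sum_eq_zero_iff.mp hm) i hiS)
    set v := padicValNat p (d i) with hv
    have hkle : p ^ v ≤ d i := Nat.le_of_dvd (Nat.pos_of_ne_zero hdi) pow_padicValNat_dvd
    have hkq : p ^ v < q := by
      rw [hq]
      apply Nat.pow_lt_pow_right hp.out.one_lt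
      by_contra hve
      push Not at hve
      exact hi (hq ▸ (padicValNat_dvd_iff_le hdi).mpr hve)
    have hkpos : 0 < p ^ v := pow_pos hp.out.pos v
    have hαd : Finsupp.single i (p ^ v) ≤ d := by
      refine Finsupp.le_def.mpr fun j => ?_
      by_cases hji : j = i
      · subst hji; rw [Finsupp.single_eq_same]; exact hkle
      · rw [Finsupp.single_eq_of_ne hji]; exact Nat.zero_le _
    have hmem : hasseDeriv (Finsupp.single i (p ^ v)) F ∈ singLocusIdeal q F :=
      Ideal.subset_span ⟨Finsupp.single i (p ^ v), by rw [Finsupp.degree_single]; exact hkpos,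
        by rw [Finsupp.degree_single]; exact hkq, rfl⟩
    refine ScopeDictionary.not_mem_span_X_of_coeff_ne_zero (β := d - Finsupp.single i (p ^ v)) ?_ ?_
      (hJ hmem)
    · rw [ScopeDictionary.coeff_sub_hasseDeriv hαd, Finsupp.support_single _ hkpos.ne',
        Finset.prod_singleton, Finsupp.single_eq_same]
      refine mul_ne_zero ?_ hcd
      rw [Ne, CharP.cast_eq_zero_iff K p]
      exact not_dvd_choose_pow_padicValNat p hdi
    · intro j hj
      have hji : j ≠ i := fun h => hiS (h ▸ hj)
      rw [Finsupp.tsub_apply, Finsupp.single_eq_of_ne hji, Nat.sub_zero]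
      exact (Finset.sum_eq_zero_iff.mp hm) j hj
  · -- `0 < deg_S d < q`: detect `x^d` with `D^{(α)}`, `α = d|_S`
    set α : Fin 4 →₀ ℕ := d.filter (fun i => i ∈ S) with hα
    have hαi : ∀ i, α i = if i ∈ S then d i else 0 := fun i => by rw [hα, Finsupp.filter_apply]
    have hαd : α ≤ d := Finsupp.le_def.mpr fun i => by rw [hαi]; split_ifs <;> omega
    have hdegα : α.degree = CentreBlowup.degIn S d := by
      rw [← CentreBlowup.degIn_univ]
      unfold CentreBlowup.degIn
      simp_rw [hαi]
      rw [Finset.sum_ite_mem, Finset.univ_inter]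
    have hmem : hasseDeriv α F ∈ singLocusIdeal q F :=
      Ideal.subset_span ⟨α, by rw [hdegα]; exact Nat.pos_of_ne_zero hm, by rw [hdegα]; exact hlt, rfl⟩
    refine ScopeDictionary.not_mem_span_X_of_coeff_ne_zero (β := d - α) ?_ ?_ (hJ hmem)
    · rw [ScopeDictionary.coeff_sub_hasseDeriv hαd, Finset.prod_eq_one fun i hi => ?_, Nat.cast_one,
        one_mul]
      · exact hcd
      · have hiS : i ∈ S := by
          by_contra hiS
          rw [Finsupp.mem_support_iff, hαi, if_neg hiS] at hi
          exact hi rfl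
        rw [hαi, if_pos hiS, Nat.choose_self]
    · intro j hj
      rw [Finsupp.tsub_apply, hαi, if_pos hj, Nat.sub_self]

/-- **PERMISSIBLE ⟺ `J_q⁺(F) ≤ (x_S)`** at every prime power `q = p^e`, for clean states (`S ≠ ∅`) over a
field of characteristic `p`. [folklore] -/
theorem isPermissibleCentre_iff_singLocusIdeal_le {p e : ℕ} [Fact p.Prime] [CharP K p] {q : ℕ}
    (hq : q = p ^ e) {S : Finset (Fin 4)} (hS : S.Nonempty) {F : MvPolynomial (Fin 4) K}
    (hclean : ∀ d ∈ F.support, ∃ i, ¬ q ∣ d i) :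
    IsPermissibleCentre q S F ↔
      singLocusIdeal q F ≤ Ideal.span ((fun i => (X i : MvPolynomial (Fin 4) K)) '' (S : Set (Fin 4))) :=
  ⟨fun h => IsolatedScope.singLocusIdeal_le_span_X h.2,
    fun h => ⟨hS, le_ordAlong_of_singLocusIdeal_le_span_X hq hclean h⟩⟩

end ScopeDictionaryPrimePower

end Summit.ResolutionOfSingularities.ResolutionOfSingularities.Theorems.PIDim4

end
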